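import Summits.Ventures.HSemireg.ObstructionLocusCrossingTFree

/-!
# Venture HSemireg — (S5) OBSTRUCTION LOCUS away from secant type, XLII: the SPLITTING LEMMA for EXT-NOTE §6.B(c)
# in the middle degrees — an extension of `Π_k R ⧸ (x_t : t ∈ T_k)` by `Π_l R ⧸ (x_t : t ∈ T″_l)` splits as soon as
# every `T_k` has two variables free on every `R ⧸ (x_t : t ∈ T″_l)` (Koszul `H¹`-vanishing, by hand, ANY ring)

HONEST FRAMING.  Part of the Lean side of the computation cell `pub-hsemireg` (track «S4-PUSH» (ii), seat
s4-prove-2).  Plain commutative / linear algebra in `R = MvPolynomial (Fin n) K`, every `n`, EVERY commutative ring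
`K`, on top of file XXXIX (`T`-free representatives modulo `J = varIdeal K T = (x_t : t ∈ T)`, non-zero-divisors
modulo `J`) and file XXVI (monomial-support divisibility by a variable).  Nothing here constructs a variety or a
sheaf; nothing here says that HC / HC_CM / HC_AV holds; no Literature fact is declared or used; no object is
certified.

WHY.  File XLI obtained EXT-NOTE §6.B(c) in a middle degree only as an EXTENSION
`0 → Π R ⧸ (J_{τ″} + (x_b, x_a)) → Ext^q(I_M, I_M) → Π R ⧸ J_{τ′} → 0` (the dévissage long exact sequence does not
split by itself), and an induction on the number of blocks cannot be carried by a filtration.  This file supplies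
the splitting, so that the induction of file XLIV carries the PRODUCT form in every degree.

CONTENT.
* **`exists_eq_X_smul_of_koszul_rel`** (Koszul `H¹` along `T` on `R̄ = R ⧸ (x_t : t ∈ T″)`): if two distinct
  variables `x_u, x_v`, `u, v ∈ T ∖ T″`, are given, every family `(m_t)_{t ∈ T}` in `R̄` with
  `x_s m_t = x_t m_s` is `m_t = x_t · y` for ONE `y ∈ R̄` (reduce to `T″`-free representatives, where
  `x_u p_v = x_v p_u` holds in `R` and forces `x_u ∣ p_u` monomial by monomial; then cancel the non-zero-divisor
  `x_u`).
* **`exists_single_lift_of_free_pairs`**: for `p : E ↠ Π_k R ⧸ varIdeal(T_k)` with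
  `ker p ≃ Π_l R ⧸ varIdeal(T″_l)` and, for every `(k, l)`, two distinct variables of `T_k` outside `T″_l`, every
  unit vector `e_k` lifts to an element of `E` killed by `varIdeal(T_k)`;
* **`exists_section_of_free_pairs`**, **`splitOfFreePairs : E ≃ₗ[R] ker p × Π_k R ⧸ varIdeal(T_k)`**
  (Mathlib's `Function.Exact.splitSurjectiveEquiv`).
References (dictionary only): EXT-NOTE.md §6.B(c).  The lemma itself is standard commutative algebra
(`Ext¹_R(R ⧸ (x_T), R ⧸ (x_{T″})) = 0` when `|T ∖ T″| ≥ 2`), proved here by hand.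
-/

open MvPolynomial Finset
open scoped BigOperators

universe u

namespace Summit.Ventures.HSemireg.ObstructionLocus.BlockModel

variable {K : Type u} [CommRing K] {n : ℕ}

/-! ## Koszul `H¹` along a set of variables two of which are non-zero-divisors -/

section Koszul

/-- **Koszul `H¹`-vanishing, by hand.**  On `R̄ = R ⧸ (x_t : t ∈ T″)` let `(m_t)_{t ∈ T}` satisfy
`x_s · m_t = x_t · m_s` for all `s, t ∈ T`.  If `T` contains two distinct coordinates `u ≠ v` outside `T″`, then
`m_t = x_t · y` for a single `y ∈ R̄` and all `t ∈ T`. -/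
theorem exists_eq_X_smul_of_koszul_rel (T T'' : Finset (Fin n)) {u v : Fin n} (hu : u ∈ T) (hv : v ∈ T)
    (huv : u ≠ v) (hu' : u ∉ T'') (hv' : v ∉ T'')
    (m : Fin n → MvPolynomial (Fin n) K ⧸ varIdeal K T'')
    (hrel : ∀ s ∈ T, ∀ t ∈ T,
      (X s : MvPolynomial (Fin n) K) • m t = (X t : MvPolynomial (Fin n) K) • m s) :
    ∃ y : MvPolynomial (Fin n) K ⧸ varIdeal K T'',
      ∀ t ∈ T, m t = (X t : MvPolynomial (Fin n) K) • y := by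
  obtain ⟨pu, hpu, hmu⟩ := exists_tfree_rep T'' (m u)
  obtain ⟨pv, hpv, hmv⟩ := exists_tfree_rep T'' (m v)
  -- `x_u p_v = x_v p_u` in `R`: the difference is `T″`-free and lies in the ideal
  have hR : X u * pv = X v * pu := by
    have hmem : X u * pv - X v * pu ∈ varIdeal K T'' := by
      rw [← Ideal.Quotient.eq, ← smul_mk_eq, ← smul_mk_eq, hmu, hmv]
      exact hrel u hu v hv
    exact sub_eq_zero.1 (eq_zero_of_tfree_of_mem T''
      (tfree_sub T'' (tfree_mul T'' (tfree_X T'' hu') hpv) (tfree_mul T'' (tfree_X T'' hv') hpu)) hmem)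
  -- every monomial of `p_u` carries `x_u`
  have hsupp : ∀ e ∈ pu.support, e u ≠ 0 := by
    intro e he
    have he' : Finsupp.single v 1 + e ∈ (X v * pu).support := by
      rw [support_X_mul, Finset.mem_map]
      exact ⟨e, he, rfl⟩
    rw [← hR] at he'
    have h1 := apply_ne_zero_of_mem_support_X_mul he'
    rwa [Finsupp.coe_add, Pi.add_apply, Finsupp.single_eq_of_ne huv, zero_add] at h1
  obtain ⟨y₀, hy₀⟩ := exists_eq_X_mul_of_forall_support hsupp
  refine ⟨Ideal.Quotient.mk (varIdeal K T'') y₀, fun t ht => ?_⟩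
  have h1 : m u = (X u : MvPolynomial (Fin n) K) • Ideal.Quotient.mk (varIdeal K T'') y₀ := by
    rw [← hmu, hy₀, smul_mk_eq]
  have h2 := hrel u hu t ht
  rw [h1, ← mul_smul, mul_comm, mul_smul] at h2
  exact X_smul_quot_injective T'' hu' h2

end Koszul

/-! ## Splitting an extension whose quotient pieces have free pairs on the sub pieces -/

section Split

variable {E : Type u} [AddCommGroup E] [Module (MvPolynomial (Fin n) K) E]
  {κ Λ : Type} [Fintype κ] [DecidableEq κ]
  (T : κ → Finset (Fin n)) (T'' : Λ → Finset (Fin n))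
  (p : E →ₗ[MvPolynomial (Fin n) K] ((k : κ) → MvPolynomial (Fin n) K ⧸ varIdeal K (T k)))
  (hp : Function.Surjective p)
  (φ : ↥(LinearMap.ker p) ≃ₗ[MvPolynomial (Fin n) K] ((l : Λ) → MvPolynomial (Fin n) K ⧸ varIdeal K (T'' l)))
  (hfree : ∀ k l, ∃ u ∈ T k, ∃ v ∈ T k, u ≠ v ∧ u ∉ T'' l ∧ v ∉ T'' l)

/-- `r • 1 = [r]` in a quotient ring of `R`. -/
theorem smul_one_eq_mk (J : Ideal (MvPolynomial (Fin n) K)) (r : MvPolynomial (Fin n) K) :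
    r • (1 : MvPolynomial (Fin n) K ⧸ J) = Ideal.Quotient.mk J r := by
  rw [← map_one (Ideal.Quotient.mk J), smul_mk_eq, mul_one]

omit [Fintype κ] in
/-- `x_t` kills the unit vector `e_k` of `Π_k R ⧸ varIdeal(T_k)` for `t ∈ T_k`. -/
theorem X_smul_single_one_eq_zero (k : κ) {t : Fin n} (ht : t ∈ T k) :
    (X t : MvPolynomial (Fin n) K) •
        (Pi.single k 1 : (k : κ) → MvPolynomial (Fin n) K ⧸ varIdeal K (T k)) = 0 := by
  rw [← Pi.single_smul, Pi.single_eq_zero_iff, smul_one_eq_mk, Ideal.Quotient.eq_zero_iff_mem]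
  exact X_mem_varIdeal _ ht

omit [Fintype κ] in
include hp φ hfree in
/-- **Every unit vector `e_k` lifts to an element of `E` killed by `varIdeal(T_k)`.**  (Lift `e_k` to `e`; the
family `(x_t e)_{t ∈ T_k}` lies in `ker p ≃ Π_l R ⧸ varIdeal(T″_l)` and satisfies the Koszul relations, so,
component by component, it is `(x_t s)_t` for one `s ∈ ker p`; take `e − s`.) -/
theorem exists_single_lift_of_free_pairs (k : κ) :
    ∃ f : E, p f = Pi.single k 1 ∧ ∀ t ∈ T k, (X t : MvPolynomial (Fin n) K) • f = 0 := by
  classical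
  obtain ⟨e, he⟩ := hp (Pi.single k 1)
  have hker : ∀ t ∈ T k, (X t : MvPolynomial (Fin n) K) • e ∈ LinearMap.ker p := by
    intro t ht
    rw [LinearMap.mem_ker, map_smul, he]
    exact X_smul_single_one_eq_zero T k ht
  -- the family `(x_t e)_t` in `ker p`
  set nn : Fin n → ↥(LinearMap.ker p) :=
    fun t => if ht : t ∈ T k then ⟨(X t : MvPolynomial (Fin n) K) • e, hker t ht⟩ else 0 with hnn
  have hnn_of_mem : ∀ t ∈ T k, (nn t : E) = (X t : MvPolynomial (Fin n) K) • e := by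
    intro t ht
    rw [hnn]
    simp only [dif_pos ht]
  have hrel : ∀ s ∈ T k, ∀ t ∈ T k,
      (X s : MvPolynomial (Fin n) K) • nn t = (X t : MvPolynomial (Fin n) K) • nn s := by
    intro s hs t ht
    apply Subtype.ext
    rw [Submodule.coe_smul, Submodule.coe_smul, hnn_of_mem s hs, hnn_of_mem t ht, ← mul_smul, ← mul_smul,
      mul_comm]
  -- component by component, the Koszul relations are solved by one element
  have hcomp : ∀ l, ∃ y : MvPolynomial (Fin n) K ⧸ varIdeal K (T'' l),
      ∀ t ∈ T k, φ (nn t) l = (X t : MvPolynomial (Fin n) K) • y := by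
    intro l
    obtain ⟨u, hu, v, hv, huv, hu', hv'⟩ := hfree k l
    refine exists_eq_X_smul_of_koszul_rel (T k) (T'' l) hu hv huv hu' hv' (fun t => φ (nn t) l) ?_
    intro s hs t ht
    have h := congrArg (fun w => φ w l) (hrel s hs t ht)
    simpa only [map_smul, Pi.smul_apply] using h
  choose y hy using hcomp
  set s : ↥(LinearMap.ker p) := φ.symm (fun l => y l) with hs
  have hs' : ∀ t ∈ T k, nn t = (X t : MvPolynomial (Fin n) K) • s := by
    intro t ht
    apply φ.injective
    funext l
    rw [hy l t ht, map_smul, Pi.smul_apply, hs, LinearEquiv.apply_symm_apply]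
  refine ⟨e - (s : E), ?_, ?_⟩
  · rw [map_sub, he, LinearMap.mem_ker.1 s.2, sub_zero]
  · intro t ht
    rw [smul_sub, ← hnn_of_mem t ht, hs' t ht, Submodule.coe_smul, sub_self]

include hp φ hfree in
/-- **A section of `p`.** -/
theorem exists_section_of_free_pairs :
    ∃ σ : ((k : κ) → MvPolynomial (Fin n) K ⧸ varIdeal K (T k)) →ₗ[MvPolynomial (Fin n) K] E,
      p ∘ₗ σ = LinearMap.id := by
  classical
  choose f hf using exists_single_lift_of_free_pairs T T'' p hp φ hfree
  -- `r ↦ r • f_k` factors through `R ⧸ varIdeal(T_k)`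
  have hle : ∀ k, varIdeal K (T k) ≤
      LinearMap.ker (LinearMap.toSpanSingleton (MvPolynomial (Fin n) K) E (f k)) := by
    intro k
    rw [varIdeal, Ideal.span_le]
    rintro _ ⟨t, ht, rfl⟩
    rw [SetLike.mem_coe, LinearMap.mem_ker, LinearMap.toSpanSingleton_apply]
    exact (hf k).2 t (Finset.mem_coe.1 ht)
  refine ⟨∑ k, (varIdeal K (T k)).liftQ (LinearMap.toSpanSingleton (MvPolynomial (Fin n) K) E (f k)) (hle k) ∘ₗ
    LinearMap.proj k, ?_⟩
  apply LinearMap.pi_ext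
  intro k x
  obtain ⟨r, rfl⟩ := Ideal.Quotient.mk_surjective x
  have hl : (varIdeal K (T k)).liftQ (LinearMap.toSpanSingleton (MvPolynomial (Fin n) K) E (f k)) (hle k)
      (Ideal.Quotient.mk (varIdeal K (T k)) r) = r • f k := by
    rw [← Ideal.Quotient.mk_eq_mk, Submodule.liftQ_apply, LinearMap.toSpanSingleton_apply]
  rw [LinearMap.comp_apply, LinearMap.id_apply, LinearMap.sum_apply, Finset.sum_eq_single k]
  · rw [LinearMap.comp_apply, LinearMap.proj_apply, Pi.single_eq_same, hl, map_smul, (hf k).1, ← Pi.single_smul,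
      smul_one_eq_mk]
  · intro k' _ hk'
    rw [LinearMap.comp_apply, LinearMap.proj_apply, Pi.single_eq_of_ne hk', map_zero]
  · intro h; exact absurd (Finset.mem_univ k) h

/-- **THE SPLITTING**: `E ≃ₗ[R] ker p × Π_k R ⧸ varIdeal(T_k)` (Mathlib's `Function.Exact.splitSurjectiveEquiv` on
the section of `exists_section_of_free_pairs`). -/
noncomputable def splitOfFreePairs :
    E ≃ₗ[MvPolynomial (Fin n) K]
      (↥(LinearMap.ker p) × ((k : κ) → MvPolynomial (Fin n) K ⧸ varIdeal K (T k))) :=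
  ((LinearMap.exact_iff.2 (Submodule.range_subtype (LinearMap.ker p)).symm).splitSurjectiveEquiv
      (Submodule.injective_subtype (LinearMap.ker p))
      ⟨Classical.choose (exists_section_of_free_pairs T T'' p hp φ hfree),
        Classical.choose_spec (exists_section_of_free_pairs T T'' p hp φ hfree)⟩).1

end Split

end Summit.Ventures.HSemireg.ObstructionLocus.BlockModel
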